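import Summits.QuantumFields.BalabanUV.T4Continuum.Support.ShellMeasureRootCompositionHistoriesSync
import Summits.QuantumFields.BalabanUV.T4Continuum.Support.ShellMeasureRootCompositionNecessity

/-!
# `T4Continuum.ShellMeasureRootCompositionNecessityClose` — THE CLOSENESS BINDER OF THE END-I OF RECORD FOR TERM
# FAMILIES IS LOAD-BEARING: a one-history ∕ one-slot model in the currency of
# `ShellMeasureRootCompositionHistoriesSync.shellWeightBound_histories_age` on which measurability, `small ⊆ C`, THE
# WALL (M1) for BOTH runs' partial laws, the window, `D ≤ D̄` and the geometric rate ALL hold, the a.e. two-run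
# CLOSENESS `hclose` FAILS, and `ShellWeightBound` FAILS for EVERY `Wsh`
(cell `pub-balaban`, sub-cell `t4`, spine estimate NE7c (node U5b); NE7c ROUND-2 crew `t4-ne7c-formalise-*` under
`t4/T4-NE7c-TRIGGER.json`, row S54 of the claim table `t4/b2b-balaban-t4-ne7c-p1/LEAVES-NE7c-P1.md` (owner booking
v2.2, journal `CLAIMS.log` l.13499, which lists CLOSENESS among the binders to be tested: «census file, NOT of record
for the countdown»), seat `b2b-balaban-t4-ne7c-formalise-leaf-01` (gen 4); file 3∕3 of the necessity census (files 1–2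
`ShellMeasureRootCompositionNecessity{,Levels}`: rate ∕ (M1) ∕ `D̄` ∕ (W1) ∕ [dict] pushes); ADDITIVE — imports
`ShellMeasureRootCompositionHistoriesSync` (S24 × S27: the END-I of record for term families, p211878) and file 1
(for the generic obstruction) ONLY, modifies nothing; 0 `def`, 0 sorry, 0 cite; the model data are literal terms.)

HONEST FRAMING.  Finite four-torus programme, rung (B)+1 only — NOT infinite volume, NOT a mass gap, NOT the Clay
problem, NOT summit progress; (B), `BetaPertHyp`, (B^μ) are not consumed.  NE7c = `T4IndicatorShell.ShellWeightBound`
is NOT PRINTED in [Balaban 1983–89] and NOT PROVED; the END-I of record `shellWeightBound_histories_age` is the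
kernel composition «NE7c ⇐ the named binders» (trigger c3).  THIS FILE IS A TOY about that END's binder SHAPES:
nothing of Bałaban's (no (2.18)-history, no effective density) is instantiated, no estimate of the cell is touched,
no binder of the real problem is discharged; (M1) for Bałaban's inductive measures stays THE wall (GAPS G-ne7cp1-1)
and the two-run closeness stays node U1b's ∕ NE3's by-name input (WALL §2 (g), W-f) — located, NOT PRINTED; spine
PROVED 0/9 before and after.  Every declaration is [folklore] kernel mathematics.  HONEST DEPENDENCY (cell,
verbatim): continuum YM on T⁴ ⇐ BetaPertH ∧ nine spine estimates (0/9 proved); BetaPertH ⇐ (D1) ∧ (D4) ∧ CAP+tail;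
G-an2-4 gates asym, D1 and NE2/3/4.

WHY THIS FILE.  In the END-I of record for history-indexed term families the two [dict] pushes of END-I are PROVED
from the (2.17)–(2.18) term structure, and what is displayed instead is the a.e. two-run CLOSENESS of the tested
variables of every live-small slot, `|u^A_s − u^B_s| ≤ ρ_{lvl s}·θ_{K,s}` under every history weight (WALL §2 (g):
node U1b ∕ NE3-species INPUT, «the EVENT that makes `piece_le` hold»).  Files 1–2 certified the other binder kinds
load-bearing in END-I's abstract currency; this file certifies CLOSENESS load-bearing in the histories END's OWN
currency (`histWeight` ∕ `histShell` ∕ `partialLaw` of `ShellMeasureRootCompositionHistories`): without it two runs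
whose slot laws are EACH perfectly anti-concentrated can disagree about «small» on half the mass at every step.

THE MODEL (every step `K`, every source `t`): common space `Ω K = ℝ`; ONE history `()` per step (`T = Toy.T`) with ONE
live-small slot `()` (`small K τ = {()}`, live slots `C = Toy.S`, level `lvl K () = K` = `Toy.lvl`); BOTH runs' history
weight `ν = volume↾[0,1]`; tested variables `u^A(ω) = ω`, `u^B(ω) = ω + 1∕2` (run B's variable SHIFTED by a half —
the two runs are NOT close); age profile `ε ≡ 1` (threshold `1` at every age); widths `ρ_j = ϑ^j` (`0 < ϑ < 1`),
constants `D^A ≡ 1` (`Toy.D`), `D^B ≡ 2`.  Then (§1) run A's history has weight `∫ χ₁(ω) = 1` and design-(i) shell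
part `∫ χ₁(ω)(1 − χ₁(ω + 1∕2)) = vol[1∕2, 1) = 1∕2` — relative shell weight EXACTLY `1∕2` at every step; (§2) the
`s`-small partial laws are `volume↾[0,1)` (run A) and `volume↾[0,1∕2)` (run B), anti-concentrated at threshold `1` with
`D = 1`, resp. `D = 2`, for EVERY width `0 ≤ ρ ≤ 1`; (§3) the closeness binder FAILS at every step with `ϑ^K < 1∕2`
(so at all large `K`), for both runs; (§4) every other binder of `shellWeightBound_histories_age` holds and the END
fails for every `Wsh` (file 1's `not_shellWeightBound_of_relShell` with the constant profile `1∕2`): `close_census`.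

WHAT THIS DOES NOT DO.  It is not evidence about node U1b's closeness for Bałaban's minimisers; it changes nothing in
the countdown; it re-exports no END.
-/

noncomputable section

open MeasureTheory Filter Set

namespace Summit.QuantumFields.BalabanUV.T4Continuum.ShellMeasureRootCompositionNecessityClose

open scoped ENNReal Topology
open Literature.MathematicalPhysics.QuantumFieldTheory.Balaban1983to89
open T4IndicatorShell (smallInd ShellWeightBound)
open T4ShellMeasure (SlotAntiConcentration)
open T4ShellMeasureLevels
open ShellMeasureRootCompositionHistories (smallProd histWeight histShell histLaw partialLaw)
open ShellMeasureRootCompositionToy (unif_univ)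
open ShellMeasureRootCompositionNecessity (not_shellWeightBound_of_relShell)

/-! ## §1 The model's history weight and shell part: relative shell weight EXACTLY `1∕2` -/

section Integrals

/-- on the one-slot small region the indicator product is the one indicator. [folklore] -/
theorem smallProd_singleton (u : Unit → ℝ → ℝ) (ϑ : Unit → ℝ) (ω : ℝ) :
    smallProd ({()} : Finset Unit) u ϑ ω = smallInd (u () ω) (ϑ ()) := by
  simp [smallProd]

/-- run A's small-field indicator at threshold `1` is the indicator of `(−∞, 1)`. [folklore] -/
theorem smallInd_id_eq_indicator (ω : ℝ) : smallInd ω 1 = (Iio (1 : ℝ)).indicator 1 ω := by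
  unfold smallInd
  by_cases h : ω < 1
  · rw [if_pos h, indicator_of_mem (mem_Iio.2 h), Pi.one_apply]
  · rw [if_neg h, indicator_of_notMem (fun h' => h (mem_Iio.1 h'))]

/-- run B's small-field indicator (variable `ω + 1∕2`, threshold `1`) is the indicator of `(−∞, 1∕2)`. [folklore] -/
theorem smallInd_shift_eq_indicator (ω : ℝ) : smallInd (ω + 1 / 2) 1 = (Iio (1 / 2 : ℝ)).indicator 1 ω := by
  unfold smallInd
  by_cases h : ω < 1 / 2
  · rw [if_pos (by linarith), indicator_of_mem (mem_Iio.2 h), Pi.one_apply]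
  · rw [if_neg (by linarith), indicator_of_notMem (fun h' => h (mem_Iio.1 h'))]

/-- the design-(i) shell integrand of run A's history — «A small, B large» — is the indicator of `[1∕2, 1)`.
[folklore] -/
theorem shellIntegrand_eq_indicator (ω : ℝ) :
    smallInd ω 1 * (1 - smallInd (ω + 1 / 2) 1) = (Ico (1 / 2 : ℝ) 1).indicator 1 ω := by
  rw [smallInd_id_eq_indicator, smallInd_shift_eq_indicator]
  by_cases h1 : ω < 1 / 2
  · rw [indicator_of_mem (mem_Iio.2 h1), indicator_of_notMem (fun h => (not_le.2 h1) (mem_Ico.1 h).1)]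
    simp
  · by_cases h2 : ω < 1
    · rw [indicator_of_mem (mem_Iio.2 h2), indicator_of_notMem (fun h => h1 (mem_Iio.1 h)),
        indicator_of_mem (mem_Ico.2 ⟨not_lt.1 h1, h2⟩)]
      simp
    · rw [indicator_of_notMem (fun h => h2 (mem_Iio.1 h)), indicator_of_notMem (fun h => h2 (mem_Ico.1 h).2)]
      simp

/-- the support cut: `(−∞,1) ∩ [0,1] = [0,1)`. [folklore] -/
theorem Iio_inter_Icc_eq : Iio (1 : ℝ) ∩ Icc 0 1 = Ico 0 1 := by
  ext x
  simp only [mem_inter_iff, mem_Iio, mem_Icc, mem_Ico]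
  constructor
  · exact fun h => ⟨h.2.1, h.1⟩
  · exact fun h => ⟨h.2, h.1, h.2.le⟩

/-- **RUN A'S HISTORY WEIGHT IS `1`**: `∫ χ₁(ω) d(volume↾[0,1]) = vol [0,1) = 1`. [folklore] -/
theorem histWeight_A :
    histWeight (volume.restrict (Icc (0 : ℝ) 1)) ({()} : Finset Unit) (fun (_ : Unit) (ω : ℝ) => ω)
      (fun _ => (1 : ℝ)) = 1 := by
  unfold histWeight
  simp_rw [smallProd_singleton, smallInd_id_eq_indicator]
  rw [integral_indicator_one measurableSet_Iio, measureReal_def, Measure.restrict_apply measurableSet_Iio,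
    Iio_inter_Icc_eq, Real.volume_Ico]
  simp

/-- **RUN A'S SHELL PART IS `1∕2`**: `∫ χ₁(ω)(1 − χ₁(ω + 1∕2)) d(volume↾[0,1]) = vol [1∕2, 1) = 1∕2`. [folklore] -/
theorem histShell_A :
    histShell (volume.restrict (Icc (0 : ℝ) 1)) ({()} : Finset Unit) (fun (_ : Unit) (ω : ℝ) => ω)
      (fun (_ : Unit) (ω : ℝ) => ω + 1 / 2) (fun _ => (1 : ℝ)) = 1 / 2 := by
  unfold histShell
  simp_rw [smallProd_singleton, shellIntegrand_eq_indicator]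
  rw [integral_indicator_one measurableSet_Ico, measureReal_def, Measure.restrict_apply measurableSet_Ico,
    show Ico (1 / 2 : ℝ) 1 ∩ Icc 0 1 = Ico (1 / 2) 1 from by
      ext x; simp only [mem_inter_iff, mem_Ico, mem_Icc]; constructor
      · exact fun h => h.1
      · exact fun h => ⟨h, by linarith [h.1], h.2.le⟩,
    Real.volume_Ico, ENNReal.toReal_ofReal (by norm_num)]
  norm_num

end Integrals

/-! ## §2 The partial laws of the one live slot and THE WALL (M1) for both runs -/

section PartialLaws

/-- on the one-history family the `s`-small partial law IS the history's law. [folklore] -/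
theorem partialLaw_singleton (ν : Measure ℝ) (u : Unit → ℝ → ℝ) (ϑ : Unit → ℝ) (K : ℕ) :
    partialLaw (Toy.T K) (fun _ : Unit => ν) (fun _ : Unit => ({()} : Finset Unit)) u ϑ () =
      histLaw ν ({()} : Finset Unit) u ϑ := by
  simp [partialLaw, Toy.T]

/-- **RUN A'S PARTIAL LAW IS `volume↾[0,1)`** (density `χ₁(ω)` against `volume↾[0,1]`). [folklore] -/
theorem histLaw_A :
    histLaw (volume.restrict (Icc (0 : ℝ) 1)) ({()} : Finset Unit) (fun (_ : Unit) (ω : ℝ) => ω) (fun _ => (1 : ℝ)) =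
      volume.restrict (Ico (0 : ℝ) 1) := by
  unfold histLaw
  have h : (fun ω : ℝ => ENNReal.ofReal (smallProd ({()} : Finset Unit) (fun (_ : Unit) (ω : ℝ) => ω)
      (fun _ => (1 : ℝ)) ω)) = (Iio (1 : ℝ)).indicator 1 := by
    funext ω
    rw [smallProd_singleton, smallInd_id_eq_indicator]
    by_cases hω : ω ∈ Iio (1 : ℝ)
    · rw [indicator_of_mem hω, indicator_of_mem hω, Pi.one_apply, Pi.one_apply, ENNReal.ofReal_one]
    · rw [indicator_of_notMem hω, indicator_of_notMem hω, ENNReal.ofReal_zero]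
  rw [h, withDensity_indicator_one measurableSet_Iio, Measure.restrict_restrict measurableSet_Iio, Iio_inter_Icc_eq]

/-- **RUN B'S PARTIAL LAW IS `volume↾[0,1∕2)`** (density `χ₁(ω + 1∕2)` against `volume↾[0,1]`). [folklore] -/
theorem histLaw_B :
    histLaw (volume.restrict (Icc (0 : ℝ) 1)) ({()} : Finset Unit) (fun (_ : Unit) (ω : ℝ) => ω + 1 / 2)
        (fun _ => (1 : ℝ)) = volume.restrict (Ico (0 : ℝ) (1 / 2)) := by
  unfold histLaw
  have h : (fun ω : ℝ => ENNReal.ofReal (smallProd ({()} : Finset Unit) (fun (_ : Unit) (ω : ℝ) => ω + 1 / 2)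
      (fun _ => (1 : ℝ)) ω)) = (Iio (1 / 2 : ℝ)).indicator 1 := by
    funext ω
    rw [smallProd_singleton, smallInd_shift_eq_indicator]
    by_cases hω : ω ∈ Iio (1 / 2 : ℝ)
    · rw [indicator_of_mem hω, indicator_of_mem hω, Pi.one_apply, Pi.one_apply, ENNReal.ofReal_one]
    · rw [indicator_of_notMem hω, indicator_of_notMem hω, ENNReal.ofReal_zero]
  rw [h, withDensity_indicator_one measurableSet_Iio, Measure.restrict_restrict measurableSet_Iio,
    show Iio (1 / 2 : ℝ) ∩ Icc 0 1 = Ico 0 (1 / 2) from by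
      ext x; simp only [mem_inter_iff, mem_Iio, mem_Icc, mem_Ico]; constructor
      · exact fun h => ⟨h.2.1, h.1⟩
      · exact fun h => ⟨h.2, h.1, by linarith [h.2]⟩]

/-- **(M1) FOR RUN A'S PARTIAL LAW, `D = 1`, EVERY WIDTH `ρ`**: under `volume↾[0,1)` the identity variable has shell
`{1 − ρ ≤ ω < 1}` of mass `≤ vol[1 − ρ, 1] = ofReal ρ = 1·ρ·vol[0,1)`. [folklore] -/
theorem slotAC_A (ρ : ℝ) :
    SlotAntiConcentration (volume.restrict (Ico (0 : ℝ) 1)) (fun ω : ℝ => ω) 1 ρ 1 := by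
  show (volume.restrict (Ico (0 : ℝ) 1)) {x : ℝ | 1 * (1 - ρ) ≤ x ∧ x < 1} ≤
    ENNReal.ofReal (1 * ρ) * (volume.restrict (Ico (0 : ℝ) 1)) univ
  have hm : MeasurableSet {x : ℝ | 1 * (1 - ρ) ≤ x ∧ x < 1} :=
    (measurableSet_Ici.preimage measurable_id).inter (measurableSet_Iio.preimage measurable_id)
  rw [Measure.restrict_apply hm, Measure.restrict_apply_univ, Real.volume_Ico, sub_zero, ENNReal.ofReal_one,
    mul_one]
  calc volume ({x : ℝ | 1 * (1 - ρ) ≤ x ∧ x < 1} ∩ Ico 0 1)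
      ≤ volume (Icc (1 - ρ) (1 : ℝ)) := measure_mono fun x hx => ⟨by linarith [hx.1.1], hx.1.2.le⟩
    _ = ENNReal.ofReal (1 * ρ) := by rw [Real.volume_Icc]; ring_nf

/-- **(M1) FOR RUN B'S PARTIAL LAW, `D = 2`, EVERY WIDTH `0 ≤ ρ`**: under `volume↾[0,1∕2)` the shifted variable
`ω + 1∕2` has shell `{1 − ρ ≤ ω + 1∕2 < 1}` of mass `≤ ρ = 2·ρ·vol[0,1∕2)`. [folklore] -/
theorem slotAC_B {ρ : ℝ} (hρ0 : 0 ≤ ρ) :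
    SlotAntiConcentration (volume.restrict (Ico (0 : ℝ) (1 / 2))) (fun ω : ℝ => ω + 1 / 2) 1 ρ 2 := by
  show (volume.restrict (Ico (0 : ℝ) (1 / 2))) {x : ℝ | 1 * (1 - ρ) ≤ x + 1 / 2 ∧ x + 1 / 2 < 1} ≤
    ENNReal.ofReal (2 * ρ) * (volume.restrict (Ico (0 : ℝ) (1 / 2))) univ
  have hmeas : Measurable fun x : ℝ => x + 1 / 2 := measurable_id.add_const _
  have hm : MeasurableSet {x : ℝ | 1 * (1 - ρ) ≤ x + 1 / 2 ∧ x + 1 / 2 < 1} :=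
    (measurableSet_Ici.preimage hmeas).inter (measurableSet_Iio.preimage hmeas)
  rw [Measure.restrict_apply hm, Measure.restrict_apply_univ, Real.volume_Ico, sub_zero,
    ← ENNReal.ofReal_mul (by linarith), show 2 * ρ * (1 / 2) = ρ from by ring]
  calc volume ({x : ℝ | 1 * (1 - ρ) ≤ x + 1 / 2 ∧ x + 1 / 2 < 1} ∩ Ico 0 (1 / 2))
      ≤ volume (Icc (1 / 2 - ρ) (1 / 2 : ℝ)) := measure_mono fun x hx => ⟨by linarith [hx.1.1], hx.2.2.le⟩
    _ = ENNReal.ofReal ρ := by rw [Real.volume_Icc]; ring_nf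

variable (l₀ : ℝ) {ϑ : ℝ}

/-- THE WALL (M1) for run A on the model, in the END's binder shape `hacA` (partial law of the live slot, threshold
`ε (K − lvl K s) = 1`, width `ϑ^{lvl K s}`, constant `D^A_{lvl K s} = 1`). [folklore] -/
theorem hacA_model : ∀ K (t : ℝ), |t| ≤ l₀ → ∀ s ∈ Toy.S K,
    SlotAntiConcentration
      (partialLaw (Toy.T K) (fun _ : Unit => volume.restrict (Icc (0 : ℝ) 1)) (fun _ : Unit => ({()} : Finset Unit))
        (fun (_ : Unit) (ω : ℝ) => ω) (fun s => (fun _ : ℕ => (1 : ℝ)) (K - Toy.lvl K s)) s)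
      ((fun (_ : Unit) (ω : ℝ) => ω) s) ((fun _ : ℕ => (1 : ℝ)) (K - Toy.lvl K s)) (Toy.ρ ϑ (Toy.lvl K s))
      (Toy.D (Toy.lvl K s)) := by
  rintro K t - ⟨⟩ -
  show SlotAntiConcentration (partialLaw (Toy.T K) (fun _ : Unit => volume.restrict (Icc (0 : ℝ) 1))
    (fun _ : Unit => ({()} : Finset Unit)) (fun (_ : Unit) (ω : ℝ) => ω) (fun _ => (1 : ℝ)) ())
    (fun ω : ℝ => ω) 1 (ϑ ^ K) 1
  rw [partialLaw_singleton, histLaw_A]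
  exact slotAC_A (ϑ ^ K)

/-- THE WALL (M1) for run B on the model, in the END's binder shape `hacB` (constant `D^B ≡ 2`). [folklore] -/
theorem hacB_model (h0 : 0 ≤ ϑ) : ∀ K (t : ℝ), |t| ≤ l₀ → ∀ s ∈ Toy.S K,
    SlotAntiConcentration
      (partialLaw (Toy.T K) (fun _ : Unit => volume.restrict (Icc (0 : ℝ) 1)) (fun _ : Unit => ({()} : Finset Unit))
        (fun (_ : Unit) (ω : ℝ) => ω + 1 / 2) (fun s => (fun _ : ℕ => (1 : ℝ)) (K - Toy.lvl K s)) s)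
      ((fun (_ : Unit) (ω : ℝ) => ω + 1 / 2) s) ((fun _ : ℕ => (1 : ℝ)) (K - Toy.lvl K s)) (Toy.ρ ϑ (Toy.lvl K s))
      ((fun _ : ℕ => (2 : ℝ)) (Toy.lvl K s)) := by
  rintro K t - ⟨⟩ -
  show SlotAntiConcentration (partialLaw (Toy.T K) (fun _ : Unit => volume.restrict (Icc (0 : ℝ) 1))
    (fun _ : Unit => ({()} : Finset Unit)) (fun (_ : Unit) (ω : ℝ) => ω + 1 / 2) (fun _ => (1 : ℝ)) ())
    (fun ω : ℝ => ω + 1 / 2) 1 (ϑ ^ K) 2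
  rw [partialLaw_singleton, histLaw_B]
  exact slotAC_B (pow_nonneg h0 K)

end PartialLaws

/-! ## §3 The closeness binder FAILS -/

section Closeness

variable {ϑ : ℝ}

/-- the two tested variables differ by EXACTLY `1∕2` everywhere. [folklore] -/
theorem abs_sub_shift (ω : ℝ) : |ω - (ω + 1 / 2)| = 1 / 2 := by
  rw [show ω - (ω + 1 / 2) = -(1 / 2 : ℝ) by ring, abs_neg, abs_of_pos (by norm_num : (0 : ℝ) < 1 / 2)]

/-- … in either order. [folklore] -/
theorem abs_sub_shift' (ω : ℝ) : |ω + 1 / 2 - ω| = 1 / 2 := by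
  rw [show ω + 1 / 2 - ω = (1 / 2 : ℝ) by ring, abs_of_pos (by norm_num : (0 : ℝ) < 1 / 2)]

/-- `volume↾[0,1]` is not the zero measure, so an a.e.-FALSE statement under it is false. [folklore] -/
theorem not_ae_false : ¬ (∀ᵐ _ω ∂(volume.restrict (Icc (0 : ℝ) 1)), False) := by
  intro h
  rw [eventually_false_iff_eq_bot, ae_eq_bot] at h
  have h1 := unif_univ
  rw [h] at h1
  simp at h1

/-- **RUN A's CLOSENESS FAILS** at every step `K` with `ϑ^K < 1∕2`: the END's binder `hcloseA` at step `K` would say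
`|ω − (ω + 1∕2)| ≤ ϑ^K · 1` for `volume↾[0,1]`-a.e. `ω`. [folklore] -/
theorem not_hcloseA {K : ℕ} (hK : ϑ ^ K < 1 / 2) (t : ℝ) :
    ¬ (∀ τ ∈ Toy.T K, ∀ s ∈ (fun (_ : ℕ) (_ : Unit) => ({()} : Finset Unit)) K τ,
      ∀ᵐ ω ∂((fun (_ : ℕ) (_ : ℝ) (_ : Unit) => volume.restrict (Icc (0 : ℝ) 1)) K t τ),
        |(fun (_ : ℕ) (_ : ℝ) (_ : Unit) (ω : ℝ) => ω) K t s ω - (fun (_ : ℕ) (_ : ℝ) (_ : Unit) (ω : ℝ) => ω + 1 / 2) K t s ω|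
          ≤ Toy.ρ ϑ (Toy.lvl K s) * (fun _ : ℕ => (1 : ℝ)) (K - Toy.lvl K s)) := by
  intro h
  have h' := h () (by simp [Toy.T]) () (by simp)
  refine not_ae_false (h'.mono fun ω hω => ?_)
  have hω' : (1 / 2 : ℝ) ≤ ϑ ^ K * 1 := by simpa only [abs_sub_shift, Toy.ρ, Toy.lvl] using hω
  linarith

/-- **RUN B's CLOSENESS FAILS** likewise (`hcloseB`: `|u^B − u^A| ≤ ρ·ε`). [folklore] -/
theorem not_hcloseB {K : ℕ} (hK : ϑ ^ K < 1 / 2) (t : ℝ) :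
    ¬ (∀ τ ∈ Toy.T K, ∀ s ∈ (fun (_ : ℕ) (_ : Unit) => ({()} : Finset Unit)) K τ,
      ∀ᵐ ω ∂((fun (_ : ℕ) (_ : ℝ) (_ : Unit) => volume.restrict (Icc (0 : ℝ) 1)) K t τ),
        |(fun (_ : ℕ) (_ : ℝ) (_ : Unit) (ω : ℝ) => ω + 1 / 2) K t s ω - (fun (_ : ℕ) (_ : ℝ) (_ : Unit) (ω : ℝ) => ω) K t s ω|
          ≤ Toy.ρ ϑ (Toy.lvl K s) * (fun _ : ℕ => (1 : ℝ)) (K - Toy.lvl K s)) := by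
  intro h
  have h' := h () (by simp [Toy.T]) () (by simp)
  refine not_ae_false (h'.mono fun ω hω => ?_)
  have hω' : (1 / 2 : ℝ) ≤ ϑ ^ K * 1 := by simpa only [abs_sub_shift', Toy.ρ, Toy.lvl] using hω
  linarith

/-- for `0 ≤ ϑ < 1` the failure is EVENTUAL IN `K`: from some step on, `ϑ^K < 1∕2`. [folklore] -/
theorem eventually_pow_lt_half (h0 : 0 ≤ ϑ) (h1 : ϑ < 1) : ∃ K₀ : ℕ, ∀ K, K₀ ≤ K → ϑ ^ K < 1 / 2 := by
  obtain ⟨n, hn⟩ := exists_pow_lt_of_lt_one (by norm_num : (0 : ℝ) < 1 / 2) h1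
  exact ⟨n, fun K hK => (pow_le_pow_of_le_one h0 h1.le hK).trans_lt hn⟩

end Closeness

/-! ## §4 Every other binder of `shellWeightBound_histories_age` holds, and the END fails for every `Wsh` -/

section Census

variable (l₀ : ℝ) {ϑ : ℝ}

/-- **THE END FAILS ON THE MODEL FOR EVERY `Wsh`**: run A's relative shell weight `histShell ∕ histWeight = 1∕2` at
every step (§1) is a non-summable lower profile (file 1's `not_shellWeightBound_of_relShell`). [folklore] -/
theorem not_shellWeightBound_model (hl₀ : 0 ≤ l₀) (Wsh : ℕ → ℝ) :
    ¬ ShellWeightBound l₀ Toy.T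
      (fun (_ : ℕ) (_ : ℝ) (_ : Unit) => histWeight (volume.restrict (Icc (0 : ℝ) 1)) ({()} : Finset Unit)
        (fun (_ : Unit) (ω : ℝ) => ω) (fun _ => (1 : ℝ)))
      (fun (_ : ℕ) (_ : ℝ) (_ : Unit) => histWeight (volume.restrict (Icc (0 : ℝ) 1)) ({()} : Finset Unit)
        (fun (_ : Unit) (ω : ℝ) => ω + 1 / 2) (fun _ => (1 : ℝ)))
      (fun (_ : ℕ) (_ : ℝ) (_ : Unit) => histShell (volume.restrict (Icc (0 : ℝ) 1)) ({()} : Finset Unit)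
        (fun (_ : Unit) (ω : ℝ) => ω) (fun (_ : Unit) (ω : ℝ) => ω + 1 / 2) (fun _ => (1 : ℝ)))
      (fun (_ : ℕ) (_ : ℝ) (_ : Unit) => histShell (volume.restrict (Icc (0 : ℝ) 1)) ({()} : Finset Unit)
        (fun (_ : Unit) (ω : ℝ) => ω + 1 / 2) (fun (_ : Unit) (ω : ℝ) => ω) (fun _ => (1 : ℝ)))
      Wsh :=
  not_shellWeightBound_of_relShell (r := fun _ => 1 / 2) hl₀
    (fun K => by simp only [Toy.T, Finset.sum_singleton, histWeight_A]; norm_num)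
    (fun K => by simp only [Toy.T, Finset.sum_singleton, histWeight_A, histShell_A]; norm_num) (fun _ => by norm_num)
    fun h => (by norm_num : (1 / 2 : ℝ) ≠ 0) (tendsto_nhds_unique tendsto_const_nhds h.tendsto_atTop_zero)

/-- **CLOSENESS NECESSITY CENSUS** (`0 ≤ l₀`, `0 < ϑ < 1`).  On the model EVERY binder of the END-I of record
`ShellMeasureRootCompositionHistoriesSync.shellWeightBound_histories_age` except the closeness pair holds —
measurability `huA`∕`huB`, `hsmall`, the signs `hDA0`∕`hDB0`∕`hρ0`, THE WALL (M1) for BOTH runs' partial laws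
(`hacA` with `D^A ≡ 1`, `hacB` with `D^B ≡ 2`), the window (W1) (`N₁ = 0`, `ν̄ = 1`), `0 < ϑ < 1`, `D^A, D^B ≤ D̄ = 2`,
the geometric rate (`c₁ = 1`) —, the closeness binders `hcloseA` AND `hcloseB` FAIL at every step `K` with
`ϑ^K < 1∕2` (hence at all large `K`), and `ShellWeightBound` FAILS FOR EVERY `Wsh`: node U1b's two-run closeness
(WALL §2 (g)) is load-bearing in the END of record — two runs with individually perfectly anti-concentrated slot laws
may disagree about «small» on half the mass at every step. [folklore] -/
theorem close_census (hl₀ : 0 ≤ l₀) (h0 : 0 < ϑ) (h1 : ϑ < 1) :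
    (∀ (K : ℕ) (t : ℝ) (s : Unit), Measurable ((fun (_ : ℕ) (_ : ℝ) (_ : Unit) (ω : ℝ) => ω) K t s)) ∧
    (∀ (K : ℕ) (t : ℝ) (s : Unit), Measurable ((fun (_ : ℕ) (_ : ℝ) (_ : Unit) (ω : ℝ) => ω + 1 / 2) K t s)) ∧
    (∀ K, ∀ τ ∈ Toy.T K, (fun (_ : ℕ) (_ : Unit) => ({()} : Finset Unit)) K τ ⊆ Toy.S K) ∧
    (∀ j, 0 ≤ Toy.D j) ∧ (∀ j, 0 ≤ (fun _ : ℕ => (2 : ℝ)) j) ∧ (∀ j, 0 ≤ Toy.ρ ϑ j) ∧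
    (∀ K (t : ℝ), |t| ≤ l₀ → ∀ s ∈ Toy.S K, SlotAntiConcentration
      (partialLaw (Toy.T K) (fun _ : Unit => volume.restrict (Icc (0 : ℝ) 1)) (fun _ : Unit => ({()} : Finset Unit))
        (fun (_ : Unit) (ω : ℝ) => ω) (fun s => (fun _ : ℕ => (1 : ℝ)) (K - Toy.lvl K s)) s)
      ((fun (_ : Unit) (ω : ℝ) => ω) s) ((fun _ : ℕ => (1 : ℝ)) (K - Toy.lvl K s)) (Toy.ρ ϑ (Toy.lvl K s))
      (Toy.D (Toy.lvl K s))) ∧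
    (∀ K (t : ℝ), |t| ≤ l₀ → ∀ s ∈ Toy.S K, SlotAntiConcentration
      (partialLaw (Toy.T K) (fun _ : Unit => volume.restrict (Icc (0 : ℝ) 1)) (fun _ : Unit => ({()} : Finset Unit))
        (fun (_ : Unit) (ω : ℝ) => ω + 1 / 2) (fun s => (fun _ : ℕ => (1 : ℝ)) (K - Toy.lvl K s)) s)
      ((fun (_ : Unit) (ω : ℝ) => ω + 1 / 2) s) ((fun _ : ℕ => (1 : ℝ)) (K - Toy.lvl K s)) (Toy.ρ ϑ (Toy.lvl K s))
      ((fun _ : ℕ => (2 : ℝ)) (Toy.lvl K s))) ∧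
    LiveWindow Toy.S Toy.lvl 0 1 ∧ (0 < ϑ ∧ ϑ < 1) ∧
    (∀ j, Toy.D j ≤ (2 : ℝ)) ∧ (∀ j, (fun _ : ℕ => (2 : ℝ)) j ≤ 2) ∧ (∀ j, Toy.ρ ϑ j ≤ 1 * ϑ ^ j) ∧
    (∀ K, ϑ ^ K < 1 / 2 → ∀ t : ℝ,
      ¬ (∀ τ ∈ Toy.T K, ∀ s ∈ (fun (_ : ℕ) (_ : Unit) => ({()} : Finset Unit)) K τ,
        ∀ᵐ ω ∂((fun (_ : ℕ) (_ : ℝ) (_ : Unit) => volume.restrict (Icc (0 : ℝ) 1)) K t τ),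
          |(fun (_ : ℕ) (_ : ℝ) (_ : Unit) (ω : ℝ) => ω) K t s ω -
              (fun (_ : ℕ) (_ : ℝ) (_ : Unit) (ω : ℝ) => ω + 1 / 2) K t s ω|
            ≤ Toy.ρ ϑ (Toy.lvl K s) * (fun _ : ℕ => (1 : ℝ)) (K - Toy.lvl K s)) ∧
      ¬ (∀ τ ∈ Toy.T K, ∀ s ∈ (fun (_ : ℕ) (_ : Unit) => ({()} : Finset Unit)) K τ,
        ∀ᵐ ω ∂((fun (_ : ℕ) (_ : ℝ) (_ : Unit) => volume.restrict (Icc (0 : ℝ) 1)) K t τ),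
          |(fun (_ : ℕ) (_ : ℝ) (_ : Unit) (ω : ℝ) => ω + 1 / 2) K t s ω -
              (fun (_ : ℕ) (_ : ℝ) (_ : Unit) (ω : ℝ) => ω) K t s ω|
            ≤ Toy.ρ ϑ (Toy.lvl K s) * (fun _ : ℕ => (1 : ℝ)) (K - Toy.lvl K s))) ∧
    (∃ K₀ : ℕ, ∀ K, K₀ ≤ K → ϑ ^ K < 1 / 2) ∧
    ∀ Wsh : ℕ → ℝ, ¬ ShellWeightBound l₀ Toy.T
      (fun (_ : ℕ) (_ : ℝ) (_ : Unit) => histWeight (volume.restrict (Icc (0 : ℝ) 1)) ({()} : Finset Unit)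
        (fun (_ : Unit) (ω : ℝ) => ω) (fun _ => (1 : ℝ)))
      (fun (_ : ℕ) (_ : ℝ) (_ : Unit) => histWeight (volume.restrict (Icc (0 : ℝ) 1)) ({()} : Finset Unit)
        (fun (_ : Unit) (ω : ℝ) => ω + 1 / 2) (fun _ => (1 : ℝ)))
      (fun (_ : ℕ) (_ : ℝ) (_ : Unit) => histShell (volume.restrict (Icc (0 : ℝ) 1)) ({()} : Finset Unit)
        (fun (_ : Unit) (ω : ℝ) => ω) (fun (_ : Unit) (ω : ℝ) => ω + 1 / 2) (fun _ => (1 : ℝ)))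
      (fun (_ : ℕ) (_ : ℝ) (_ : Unit) => histShell (volume.restrict (Icc (0 : ℝ) 1)) ({()} : Finset Unit)
        (fun (_ : Unit) (ω : ℝ) => ω + 1 / 2) (fun (_ : Unit) (ω : ℝ) => ω) (fun _ => (1 : ℝ)))
      Wsh :=
  ⟨fun _ _ _ => measurable_id, fun _ _ _ => measurable_id.add_const _, fun _ _ _ => by simp [Toy.S],
    fun _ => zero_le_one, fun _ => zero_le_two, fun j => pow_nonneg h0.le j, hacA_model l₀, hacB_model l₀ h0.le,
    Toy.liveWindow, ⟨h0, h1⟩, fun _ => one_le_two, fun _ => le_rfl, ShellMeasureRootCompositionToy.toy_rate h0.le le_rfl,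
    fun _ hK t => ⟨not_hcloseA hK t, not_hcloseB hK t⟩, eventually_pow_lt_half h0.le h1,
    not_shellWeightBound_model l₀ hl₀⟩

end Census

end Summit.QuantumFields.BalabanUV.T4Continuum.ShellMeasureRootCompositionNecessityClose

end
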